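/-
Copyright (c) 2026 the pub-hodgecm-mathlib formalisation cell (harness21).  Prover seat hodgecm-mathlib-K2Liu-p09 (g5): Track B «K2-LIT»,
hLiu418 = stmt-HodgeConjecture-24832; LEAD F0P6-plan (g12) RULINGS M-156m∕M-156o «A7 = GK COCYCLE ROAD», file B4 (abstract core).
-/
import Mathlib.MeasureTheory.Integral.Prod
import Mathlib.MeasureTheory.Integral.Bochner.Basic
import HarnessLib

/-!
# Crux `HLiu418`, road `K2_Liu`, organ A7-reg (GK cocycle road), file B4 (abstract core):
# THE ITERATED RANK-ONE COCYCLE — `∫_{N_Δ} f(w_Δ n h) dn = c · ∫_x ∫_z ∫_y f(A(y) B(z) C(x) h)` and its integrability from the `|f|`-chain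

Cell `hodgecm-mathlib`, crux item hLiu418 = `stmt-HodgeConjecture-24832`; squad K2 ∕ K2Liu; prover K2Liu-p09 (g5).
THEOREMS ONLY (no `def`, no instance, no notation, no named-fact hypothesis, no `sorry`); lane `--supports stmt-HodgeConjecture-24832`
(count-neutral helper).  GROUP-ABSTRACT and FRAME-AGNOSTIC (RULING M-156o (c): the concrete frame is K2Liu-p03 (g6)'s `U(J₄)` letters ★
`K2LiuDoubledUTwoTwoBorelFrame` ∕ ★ `K2LiuDoubledUTwoTwoWeylCocycle` transported by B1b; this file is what B4-concrete instantiates).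

THE SETTING.  A group `H`, a measurable space `N` with a measure `νN` and a map `ι : N → H` (in B4-concrete: `N = ↥unipDeltaLocal`, `ι` the
coercion, `νN` its Haar measure), three measure spaces `X, Zm, Yi` (the root lines `F_v, E ⊗ F_v, F_v`) with a measurable equivalence
`coord : X × (Zm × Yi) ≃ᵐ N` transporting the product measure up to a constant `c` (`νN = c • map coord (μX ⊗ μZm ⊗ μYi)`, Haar uniqueness in
B4-concrete), an element `w_Δ : H` and three maps `A : Yi → H`, `B : Zm → H`, `C : X → H` satisfying the COCYCLE WORD
  `w_Δ · ι(coord(x,z,y)) = A(y) · B(z) · C(x)`       (★ `weylSiegel_mul_nSiegel`: `A = w₂u₂`, `B = w₁u₋`, `C = w₂u₂`).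
CONTENTS.
* §1 `integral_comp_eq_iterated` — for `f : H → ℂ`, `h : H` with `p ↦ f(A(y) B(z) C(x) h)` integrable on the product:
  `∫_N f(w_Δ ι(n) h) dνN = c · ∫_x ∫_z ∫_y f(A(y) (B(z) (C(x) h)))` (change of variables + Fubini twice) — i.e. `M = c · 𝒞 ∘ ℬ ∘ 𝒜` with the
  rank-one operators `𝒜f(g) = ∫_y f(A(y) g)`, `ℬ`, `𝒞` of ★ `K2LiuRankOneOperators`.
* §2 `integrable_of_iterated` — the product integrability from a.e.-strong measurability and THREE rank-one integrabilities of the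
  `|f|`-chain: `y ↦ ‖f(A y g)‖` (every `g`), `z ↦ 𝒜|f|(B z g′)` (every `g′`), `x ↦ ℬ𝒜|f|(C x h)` (Tonelli: the iterated lower integral is
  `ofReal` of the iterated real integral, hence finite) — in B4-concrete each is ★ `K2LiuRankOneOperators.integrable_and_integral_eq` applied to
  the non-negative section `|f|` (character `|χ| = 1`, real exponent `re e > 1`).
HONEST LABEL.  `HC_CM` is proved only modulo the 7 printed citations (2 remaining named inputs: hLiu418 = `stmt-HodgeConjecture-24832`,
h413 = `stmt-HodgeConjecture-24833`) until rung 0 closes.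

## References
* [Casselman1980] W. Casselman, *The unramified principal series of p-adic groups I*, Compositio Math. 40 (1980), §3 Thm. 3.1 (the cocycle
  `T_w = T_{s₂} T_{s₁} T_{s₂}` along a reduced word).
* [HarrisKudlaSweet1996] M. Harris, S. Kudla, W. J. Sweet, J. AMS 9 (1996), §6 (6.14)–(6.16) (the Siegel intertwining operator factor by factor).
* [Tate1950] J. Tate (1950), §2.4 (absolute convergence, Tonelli shell by shell).
-/

set_option autoImplicit false
set_option linter.dupNamespace false -- the mandated namespace repeats `HodgeConjecture.HodgeConjecture`

noncomputable section

open MeasureTheory Filter Topology Set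
open scoped NNReal ENNReal

namespace Summit.HodgeConjecture.HodgeConjecture.Cruxes.HLiu418.K2LiuIteratedRankOneCocycle

variable {H : Type*} [Group H] {N X Zm Yi : Type*} [MeasurableSpace N] [MeasurableSpace X] [MeasurableSpace Zm] [MeasurableSpace Yi]
  (νN : Measure N) (μX : Measure X) (μZ : Measure Zm) (μY : Measure Yi) [SFinite μX] [SFinite μZ] [SFinite μY]
  (ι : N → H) (coord : X × (Zm × Yi) ≃ᵐ N) (c : ℝ≥0∞) (wΔ : H) (A : Yi → H) (B : Zm → H) (C : X → H)

/-! ## §1 Change of variables + Fubini: the intertwining integral as an iterated rank-one integral -/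

/-- **THE ITERATED COCYCLE.**  If `νN = c • map coord (μX ⊗ μZ ⊗ μY)` and `w_Δ · ι(coord(x,z,y)) = A(y) B(z) C(x)`, then for every `f`, `h` with
`p ↦ f(A(p.2.2) (B(p.2.1) (C(p.1) h)))` integrable on the product,
`∫_N f(w_Δ · ι n · h) dνN = c · ∫_x ∫_z ∫_y f(A(y) (B(z) (C(x) h))) dμY dμZ dμX`.
[cite: Casselman1980, §3 Thm. 3.1] [cite: HarrisKudlaSweet1996, §6 (6.14)] -/
theorem integral_comp_eq_iterated (hν : νN = c • Measure.map coord (μX.prod (μZ.prod μY)))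
    (hword : ∀ (x : X) (z : Zm) (y : Yi), wΔ * ι (coord (x, (z, y))) = A y * B z * C x)
    (f : H → ℂ) (h : H) (hint : Integrable (fun p : X × (Zm × Yi) => f (A p.2.2 * (B p.2.1 * (C p.1 * h)))) (μX.prod (μZ.prod μY))) :
    ∫ n, f (wΔ * ι n * h) ∂νN = (c.toReal : ℂ) * ∫ x, ∫ z, ∫ y, f (A y * (B z * (C x * h))) ∂μY ∂μZ ∂μX := by
  rw [hν, integral_smul_measure, integral_map_equiv]
  have hfun : (fun p : X × (Zm × Yi) => f (wΔ * ι (coord p) * h)) = fun p => f (A p.2.2 * (B p.2.1 * (C p.1 * h))) := by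
    funext p
    rcases p with ⟨x, z, y⟩
    show f (wΔ * ι (coord (x, (z, y))) * h) = _
    rw [hword x z y, mul_assoc, mul_assoc]
  rw [hfun, integral_prod _ hint, Complex.real_smul]
  congr 1
  refine integral_congr_ae ?_
  filter_upwards [hint.prod_right_ae] with x hx
  exact integral_prod _ hx

/-! ## §2 Integrability on the product from the `|f|`-chain (Tonelli) -/

omit [SFinite μX] in
/-- **Integrability of the cocycle integrand from three rank-one integrabilities.**  With `F(x,z,y) = f(A(y) (B(z) (C(x) h)))` a.e.-strongly
measurable on the product, suppose (I1) `y ↦ ‖f(A y g)‖` is integrable for every `g`, (I2) `z ↦ ∫_y ‖f(A y (B z g′))‖` is integrable for every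
`g′`, (I3) `x ↦ ∫_z ∫_y ‖f(A y (B z (C x h)))‖` is integrable.  Then `F` is integrable on `μX ⊗ μZ ⊗ μY` (the iterated lower integral of `‖F‖`
is `ofReal` of the iterated Bochner integral of the non-negative chain, hence finite). [cite: Tate1950, §2.4] [cite: Casselman1980, §3] -/
theorem integrable_of_iterated (f : H → ℂ) (h : H)
    (hmeas : AEStronglyMeasurable (fun p : X × (Zm × Yi) => f (A p.2.2 * (B p.2.1 * (C p.1 * h)))) (μX.prod (μZ.prod μY)))
    (hI1 : ∀ g : H, Integrable (fun y => ‖f (A y * g)‖) μY)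
    (hI2 : ∀ g' : H, Integrable (fun z => ∫ y, ‖f (A y * (B z * g'))‖ ∂μY) μZ)
    (hI3 : Integrable (fun x => ∫ z, ∫ y, ‖f (A y * (B z * (C x * h)))‖ ∂μY ∂μZ) μX) :
    Integrable (fun p : X × (Zm × Yi) => f (A p.2.2 * (B p.2.1 * (C p.1 * h)))) (μX.prod (μZ.prod μY)) := by
  set F : X × (Zm × Yi) → ℂ := fun p => f (A p.2.2 * (B p.2.1 * (C p.1 * h))) with hF
  refine ⟨hmeas, ?_⟩
  -- the inner lower integrals are `ofReal` of Bochner integrals of non-negative integrable functions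
  have hinner : ∀ (x : X) (z : Zm), ∫⁻ y, ‖F (x, (z, y))‖ₑ ∂μY = ENNReal.ofReal (∫ y, ‖f (A y * (B z * (C x * h)))‖ ∂μY) := by
    intro x z
    rw [ofReal_integral_eq_lintegral_ofReal (hI1 _) (Filter.Eventually.of_forall fun y => norm_nonneg _)]
    refine lintegral_congr fun y => ?_
    rw [hF]
    exact (ofReal_norm _).symm
  have hmiddle : ∀ x : X, ∫⁻ z, ∫⁻ y, ‖F (x, (z, y))‖ₑ ∂μY ∂μZ = ENNReal.ofReal (∫ z, ∫ y, ‖f (A y * (B z * (C x * h)))‖ ∂μY ∂μZ) := by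
    intro x
    simp_rw [hinner x]
    rw [ofReal_integral_eq_lintegral_ofReal (hI2 _) (Filter.Eventually.of_forall fun z => integral_nonneg fun y => norm_nonneg _)]
  have houter : ∫⁻ x, ∫⁻ z, ∫⁻ y, ‖F (x, (z, y))‖ₑ ∂μY ∂μZ ∂μX =
      ENNReal.ofReal (∫ x, ∫ z, ∫ y, ‖f (A y * (B z * (C x * h)))‖ ∂μY ∂μZ ∂μX) := by
    simp_rw [hmiddle]
    rw [ofReal_integral_eq_lintegral_ofReal hI3
      (Filter.Eventually.of_forall fun x => integral_nonneg fun z => integral_nonneg fun y => norm_nonneg _)]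
  -- Tonelli on the product
  have hprod : ∫⁻ p, ‖F p‖ₑ ∂(μX.prod (μZ.prod μY)) = ∫⁻ x, ∫⁻ z, ∫⁻ y, ‖F (x, (z, y))‖ₑ ∂μY ∂μZ ∂μX := by
    rw [lintegral_prod _ hmeas.enorm]
    refine lintegral_congr_ae ?_
    filter_upwards [hmeas.prodMk_left] with x hx
    exact lintegral_prod _ (AEStronglyMeasurable.enorm hx)
  show ∫⁻ p, ‖F p‖ₑ ∂(μX.prod (μZ.prod μY)) < ∞
  rw [hprod, houter]
  exact ENNReal.ofReal_lt_top

/-- **Cocycle + integrability packaged.** [cite: Casselman1980, §3 Thm. 3.1] [cite: HarrisKudlaSweet1996, §6 (6.14)] -/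
theorem integral_comp_eq_iterated_of_chain (hν : νN = c • Measure.map coord (μX.prod (μZ.prod μY))) (hc : c ≠ ∞)
    (hword : ∀ (x : X) (z : Zm) (y : Yi), wΔ * ι (coord (x, (z, y))) = A y * B z * C x)
    (f : H → ℂ) (h : H)
    (hmeas : AEStronglyMeasurable (fun p : X × (Zm × Yi) => f (A p.2.2 * (B p.2.1 * (C p.1 * h)))) (μX.prod (μZ.prod μY)))
    (hI1 : ∀ g : H, Integrable (fun y => ‖f (A y * g)‖) μY)
    (hI2 : ∀ g' : H, Integrable (fun z => ∫ y, ‖f (A y * (B z * g'))‖ ∂μY) μZ)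
    (hI3 : Integrable (fun x => ∫ z, ∫ y, ‖f (A y * (B z * (C x * h)))‖ ∂μY ∂μZ) μX) :
    Integrable (fun n => f (wΔ * ι n * h)) νN ∧
      ∫ n, f (wΔ * ι n * h) ∂νN = (c.toReal : ℂ) * ∫ x, ∫ z, ∫ y, f (A y * (B z * (C x * h))) ∂μY ∂μZ ∂μX := by
  have hint := integrable_of_iterated μX μZ μY A B C f h hmeas hI1 hI2 hI3
  refine ⟨?_, integral_comp_eq_iterated νN μX μZ μY ι coord c wΔ A B C hν hword f h hint⟩
  rw [hν]
  refine Integrable.smul_measure ?_ hc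
  rw [integrable_map_equiv]
  have hfun : ((fun n => f (wΔ * ι n * h)) ∘ coord) = fun p : X × (Zm × Yi) => f (A p.2.2 * (B p.2.1 * (C p.1 * h))) := by
    funext p
    rcases p with ⟨x, z, y⟩
    show f (wΔ * ι (coord (x, (z, y))) * h) = _
    rw [hword x z y, mul_assoc, mul_assoc]
  rw [hfun]
  exact hint
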